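import Summits.PneNP.PneNP.Theorems.SymmetryBudgetNoHiddenOrderProgramGatesSym
import Summits.PneNP.PneNP.Theorems.SymmetryBudgetNoHiddenOrderValueAndDefs

/-!
# `NoHiddenOrder` (stmt-PneNP-14781), (R2c) VI: the window canoniser program — finset bookkeeping for source equivariance

Route `PneNP/SymmetryBudget`; companion of `…ProgramGatesSym.lean`.  The source sets of the larger gate shapes (`DAnalysis`, `Decode`,
`VOr`, `VAnd`, `Value` modules of seat -1) are images over index finsets that MOVE with the label: the block `U`, the named set `X`,
`univ \ U'`, `U ×ˢ U`, the proper non-empty parts `partSets U`, with side conditions `y ∈ X`, `u ∈ U''`, `U' ∈ partSets U`, `U.card = 1`,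
`(i - t) % |U'|`.  This file is the bookkeeping that makes their equivariance under `fs σ = Finset.map σ` one rewrite each:
reindexing an image of an image along a relabelled index finset (`image_image_map_equiv`, `image_image_fs`, products `fs_product`,
`image_image_fs_product`), `fs` versus the finset operations (`fs_univ`, `fs_empty`, `fs_sdiff`, `fs_insert`, `fs_singleton`, `card_fs`,
`fs_nonempty_iff`, `fs_inj`, `mem_fs`, `fs_subset_fs`, `fs_ssubset_fs`), and the parts: `fs_mem_partSets_iff`, `partSets_fs`
(`partSets (fs σ U) = (partSets U).map _`), `image_image_partSets`.  Sorry-free; supports stmt-PneNP-14781, does not close it.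
-/

set_option linter.dupNamespace false -- `Summit.PneNP.PneNP.…` (D-0017 single-conjunct layout)

namespace Summit.PneNP.PneNP.Theorems

open Finset

namespace WCanon

variable {m : ℕ}

/-! ### Reindexing along a relabelled index finset -/

/-- The image of an image over a finset, reindexed along an equivalence. [folklore] -/
theorem image_image_map_equiv {α α' β γ : Type*} [DecidableEq α'] [DecidableEq β] [DecidableEq γ] (σ : α ≃ α') (s : Finset α) (f : α → β)
    (F : β → γ) (f' : α' → γ) (h : ∀ a, F (f a) = f' (σ a)) : (s.image f).image F = (s.map σ.toEmbedding).image f' := by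
  rw [Finset.image_image, Finset.map_eq_image, Finset.image_image]
  exact congrArg (fun g : α → γ => s.image g) (funext fun a => h a : F ∘ f = f' ∘ σ)

/-- The image of an image over a part block, reindexed along `fs σ`. [folklore] -/
theorem image_image_fs {β γ : Type*} [DecidableEq β] [DecidableEq γ] (σ : Equiv.Perm (WV m)) (U : Finset (WV m)) (f : WV m → β)
    (F : β → γ) (f' : WV m → γ) (h : ∀ a, F (f a) = f' (σ a)) : (U.image f).image F = (fs σ U).image f' :=
  image_image_map_equiv σ U f F f' h

/-! ### `fs` versus the finset operations -/

/-- `σ v ∈ fs σ U ↔ v ∈ U`. [folklore] -/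
@[simp] theorem mem_fs (σ : Equiv.Perm (WV m)) (U : Finset (WV m)) (v : WV m) : σ v ∈ fs σ U ↔ v ∈ U := by
  unfold fs; exact Finset.mem_map' _

/-- `fs σ univ = univ`. [folklore] -/
@[simp] theorem fs_univ (σ : Equiv.Perm (WV m)) : fs σ (univ : Finset (WV m)) = univ := Finset.map_univ_equiv σ

/-- `fs σ ∅ = ∅`. [folklore] -/
@[simp] theorem fs_empty (σ : Equiv.Perm (WV m)) : fs σ (∅ : Finset (WV m)) = ∅ := Finset.map_empty _

/-- `fs σ {v} = {σ v}`. [folklore] -/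
@[simp] theorem fs_singleton (σ : Equiv.Perm (WV m)) (v : WV m) : fs σ {v} = {σ v} := Finset.map_singleton _ _

/-- `fs σ (insert v U) = insert (σ v) (fs σ U)`. [folklore] -/
@[simp] theorem fs_insert (σ : Equiv.Perm (WV m)) (v : WV m) (U : Finset (WV m)) : fs σ (insert v U) = insert (σ v) (fs σ U) :=
  Finset.map_insert _ _ _

/-- `fs` commutes with set difference. [folklore] -/
theorem fs_sdiff (σ : Equiv.Perm (WV m)) (s t : Finset (WV m)) : fs σ (s \ t) = fs σ s \ fs σ t := by
  ext v; simp [mem_fs_iff]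

/-- `fs` commutes with union. [folklore] -/
theorem fs_union (σ : Equiv.Perm (WV m)) (s t : Finset (WV m)) : fs σ (s ∪ t) = fs σ s ∪ fs σ t := Finset.map_union _ _

/-- `fs` commutes with intersection. [folklore] -/
theorem fs_inter (σ : Equiv.Perm (WV m)) (s t : Finset (WV m)) : fs σ (s ∩ t) = fs σ s ∩ fs σ t := Finset.map_inter _ _

/-- `fs` commutes with filtering by a relabelled predicate. [folklore] -/
theorem fs_filter (σ : Equiv.Perm (WV m)) (s : Finset (WV m)) (p : WV m → Prop) [DecidablePred p] :
    fs σ (s.filter p) = (fs σ s).filter fun v => p (σ.symm v) := by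
  ext v
  simp only [mem_fs_iff, mem_filter]

/-- `fs` preserves cardinality. [folklore] -/
@[simp] theorem card_fs (σ : Equiv.Perm (WV m)) (U : Finset (WV m)) : (fs σ U).card = U.card := Finset.card_map _

/-- `fs` preserves non-emptiness. [folklore] -/
@[simp] theorem fs_nonempty_iff (σ : Equiv.Perm (WV m)) (U : Finset (WV m)) : (fs σ U).Nonempty ↔ U.Nonempty := Finset.map_nonempty

/-- `fs σ` is injective. [folklore] -/
@[simp] theorem fs_inj (σ : Equiv.Perm (WV m)) (U U' : Finset (WV m)) : fs σ U = fs σ U' ↔ U = U' := Finset.map_inj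

/-- `fs σ` is monotone and reflects inclusion. [folklore] -/
@[simp] theorem fs_subset_fs (σ : Equiv.Perm (WV m)) (U U' : Finset (WV m)) : fs σ U ⊆ fs σ U' ↔ U ⊆ U' := Finset.map_subset_map

/-- `fs σ` preserves and reflects strict inclusion. [folklore] -/
@[simp] theorem fs_ssubset_fs (σ : Equiv.Perm (WV m)) (U U' : Finset (WV m)) : fs σ U ⊂ fs σ U' ↔ U ⊂ U' := Finset.map_ssubset_map

/-- `fs` of a product of blocks. [folklore] -/
theorem fs_product (σ : Equiv.Perm (WV m)) (s t : Finset (WV m)) :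
    (s ×ˢ t).map (σ.prodCongr σ).toEmbedding = fs σ s ×ˢ fs σ t := by
  ext ⟨a, b⟩
  simp only [Finset.mem_map_equiv, Finset.mem_product, mem_fs_iff]
  rfl

/-- The image of an image over a product of blocks, reindexed. [folklore] -/
theorem image_image_fs_product {β γ : Type*} [DecidableEq β] [DecidableEq γ] (σ : Equiv.Perm (WV m)) (s t : Finset (WV m))
    (f : WV m × WV m → β) (F : β → γ) (f' : WV m × WV m → γ) (h : ∀ a b, F (f (a, b)) = f' (σ a, σ b)) :
    ((s ×ˢ t).image f).image F = (fs σ s ×ˢ fs σ t).image f' := by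
  rw [← fs_product]
  exact image_image_map_equiv (σ.prodCongr σ) _ f F f' fun ab => h ab.1 ab.2

/-- The image of an image over a product of a block with a fixed index set, reindexed. [folklore] -/
theorem image_image_fs_product_left {ι β γ : Type*} [DecidableEq ι] [DecidableEq β] [DecidableEq γ] (σ : Equiv.Perm (WV m)) (s : Finset (WV m))
    (t : Finset ι) (f : WV m × ι → β) (F : β → γ) (f' : WV m × ι → γ) (h : ∀ a i, F (f (a, i)) = f' (σ a, i)) :
    ((s ×ˢ t).image f).image F = (fs σ s ×ˢ t).image f' := by
  have hm : (s ×ˢ t).map (σ.prodCongr (Equiv.refl ι)).toEmbedding = fs σ s ×ˢ t := by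
    ext ⟨a, i⟩
    simp only [Finset.mem_map_equiv, Finset.mem_product, mem_fs_iff]
    rfl
  rw [← hm]
  exact image_image_map_equiv (σ.prodCongr (Equiv.refl ι)) _ f F f' fun ai => h ai.1 ai.2

/-! ### The proper non-empty parts -/

/-- Membership of a relabelled block in the parts of a relabelled block. [folklore] -/
@[simp] theorem fs_mem_partSets_iff (σ : Equiv.Perm (WV m)) (U U' : Finset (WV m)) : fs σ U' ∈ partSets (fs σ U) ↔ U' ∈ partSets U := by
  simp only [partSets, mem_filter, mem_powerset, fs_subset_fs, fs_nonempty_iff, ne_eq, fs_inj]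

/-- Every part of a relabelled block is a relabelled part. [folklore] -/
theorem exists_fs_of_mem_partSets {σ : Equiv.Perm (WV m)} {U V : Finset (WV m)} (h : V ∈ partSets (fs σ U)) :
    ∃ U', U' ∈ partSets U ∧ fs σ U' = V := by
  refine ⟨fs σ.symm V, ?_, fs_fs_symm σ V⟩
  rw [← fs_mem_partSets_iff σ, fs_fs_symm]
  exact h

/-- **The parts of a relabelled block are the relabelled parts.** [folklore] -/
theorem partSets_fs (σ : Equiv.Perm (WV m)) (U : Finset (WV m)) : partSets (fs σ U) = (partSets U).image (fs σ) := by
  ext V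
  rw [mem_image]
  constructor
  · intro h
    exact exists_fs_of_mem_partSets h
  · rintro ⟨U', hU', rfl⟩
    exact (fs_mem_partSets_iff σ U U').2 hU'

/-- The image of an image over the parts, reindexed. [folklore] -/
theorem image_image_partSets {β γ : Type*} [DecidableEq β] [DecidableEq γ] (σ : Equiv.Perm (WV m)) (U : Finset (WV m))
    (f : Finset (WV m) → β) (F : β → γ) (f' : Finset (WV m) → γ) (h : ∀ U', F (f U') = f' (fs σ U')) :
    ((partSets U).image f).image F = (partSets (fs σ U)).image f' := by
  rw [partSets_fs, Finset.image_image, Finset.image_image]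
  exact congrArg (fun g : Finset (WV m) → γ => (partSets U).image g) (funext fun a => h a : F ∘ f = f' ∘ fs σ)

/-- The image of an image over parts × vertices, reindexed. [folklore] -/
theorem image_image_partSets_product_univ {β γ : Type*} [DecidableEq β] [DecidableEq γ] (σ : Equiv.Perm (WV m)) (U : Finset (WV m))
    (f : Finset (WV m) × WV m → β) (F : β → γ) (f' : Finset (WV m) × WV m → γ) (h : ∀ U' u, F (f (U', u)) = f' (fs σ U', σ u)) :
    ((partSets U ×ˢ (univ : Finset (WV m))).image f).image F = (partSets (fs σ U) ×ˢ (univ : Finset (WV m))).image f' := by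
  have hm : (partSets U ×ˢ (univ : Finset (WV m))).image (fun p => (fs σ p.1, σ p.2)) = partSets (fs σ U) ×ˢ univ := by
    ext ⟨V, v⟩
    simp only [mem_image, mem_product, mem_univ, and_true, Prod.mk.injEq, partSets_fs]
    constructor
    · rintro ⟨⟨U', u⟩, hU', rfl, rfl⟩
      exact ⟨U', hU', rfl⟩
    · rintro ⟨U', hU', rfl⟩
      exact ⟨⟨U', σ.symm v⟩, hU', rfl, by simp⟩
  rw [← hm, Finset.image_image, Finset.image_image]
  exact congrArg (fun g : Finset (WV m) × WV m → γ => (partSets U ×ˢ (univ : Finset (WV m))).image g)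
    (funext fun a => h a.1 a.2 : F ∘ f = f' ∘ fun p => (fs σ p.1, σ p.2))

/-! ### Candidates -/

/-- The components of a relabelled candidate. [folklore] -/
@[simp] theorem cκ_fst (σ : Equiv.Perm (WV m)) (κ : WV m × Fin (wn m)) : (cκ σ κ).1 = σ κ.1 := rfl

/-- The components of a relabelled candidate. [folklore] -/
@[simp] theorem cκ_snd (σ : Equiv.Perm (WV m)) (κ : WV m × Fin (wn m)) : (cκ σ κ).2 = κ.2 := rfl

/-- `cκ σ` as an equivalence. [folklore] -/
def cκEquiv (σ : Equiv.Perm (WV m)) : Equiv.Perm (WV m × Fin (wn m)) := σ.prodCongr (Equiv.refl _)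

/-- `cκEquiv` acts as `cκ`. [folklore] -/
@[simp] theorem cκEquiv_apply (σ : Equiv.Perm (WV m)) (κ : WV m × Fin (wn m)) : cκEquiv σ κ = cκ σ κ := rfl

/-- The image of an image over all candidates, reindexed. [folklore] -/
theorem image_image_univ_cκ {β γ : Type*} [DecidableEq β] [DecidableEq γ] (σ : Equiv.Perm (WV m)) (f : WV m × Fin (wn m) → β)
    (F : β → γ) (f' : WV m × Fin (wn m) → γ) (h : ∀ κ, F (f κ) = f' (cκ σ κ)) : (univ.image f).image F = univ.image f' := by
  rw [image_image_map_equiv (cκEquiv σ) univ f F f' h, Finset.map_univ_equiv]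

end WCanon

end Summit.PneNP.PneNP.Theorems
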